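import Summits.QuantumFields.QCD.Theorems.QuarksAsStableActionStableActionBridgeSliceNilpotent
import Summits.QuantumFields.QCD.Theorems.QuarksAsStableActionStableActionBridgeSliceMassHopPosDef

/-!
# Flavour block structure of the fermionic one-particle transfer matrix
(helper for crux stmt-QuantumFields-9737 `QuarksAsStableAction.StableActionBridge`, line `Sketch`;
stubs `fermionSliceMatrix_flavour_apply` and `det_one_sub_transfer_prod_eq_prod_flavour`)

Smit's one-particle matrix of the fermionic one-step transfer operator of `r = 1` Wilson
quarks, `M_F(U) = (1 − N)(A⁻¹ ⊗ P⁺ + A ⊗ P⁻)(1 − N)ᴴ` (`fermionSliceMatrix`, Smit §6.5 (6.91)),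
acts on the slice quark modes `flavour × (site × colour × spin)`.  Every constituent — the
colour hops `W_j` (`colourHop`), the mass-plus-hop operator `A = diag(m_f + 4) − ½Σ_j(W_j + W_jᴴ)`
(`sliceMassHop`), the kinetic term `D` (`sliceDiracKinetic`), the pair coupling `N` (`sliceNilp`)
and the gauge rotation (`sliceGaugeRot`) — is diagonal in the flavour index, the `f`-block being
the same object for ONE flavour of mass `m_f`.  Hence so is `M_F(U)` (the inverse `A⁻¹` is taken
blockwise, legitimate because every one-flavour block `A_f` is positive definite for `m_f > −1`,
`sliceMassHop_posDef`), and the determinant of `1 − Π_i M_F(U_i) R(g_i)` over the time slices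
factorises over flavours.

We phrase "flavour-block-diagonal with one-flavour blocks `b f`" as the explicit hypothesis
`∀ f g x y, M (f, x) (g, y) = if f = g then b f (0, x) (0, y) else 0` (blocks indexed by
`Fin 1 × α`, flavour component `0 : Fin 1`) and record its closure under the matrix operations
(`FlavourBlocks.*`), the determinant formula `det M = Π_f det (b f)` (via `Matrix.blockDiagonal`),
and the instances for the tree's slice matrices.  Pure theorem file (no definitions).
[cite: Smit2023, §6.5 (6.74)–(6.91)]
-/

noncomputable section

namespace Summit.QuantumFields.QCD.Cruxes.StableActionBridge.Sketch

open scoped ComplexOrder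
open MeasureTheory Matrix Literature.MathematicalPhysics.QuantumFieldTheory
  Literature.MathematicalPhysics.QuantumLattice
open Literature.Probability.LatticeModels (TorusSite)

namespace FlavourBlocks

/-! ### Closure properties of flavour-block-diagonal matrices -/

section Generic

variable {Nf : ℕ} {α : Type*}

/-- Sums of flavour-block-diagonal matrices are flavour-block-diagonal, blockwise. -/
theorem add_flavour {M₁ M₂ : Matrix (Fin Nf × α) (Fin Nf × α) ℂ}
    {b₁ b₂ : Fin Nf → Matrix (Fin 1 × α) (Fin 1 × α) ℂ}
    (h₁ : ∀ f g x y, M₁ (f, x) (g, y) = if f = g then b₁ f (0, x) (0, y) else 0)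
    (h₂ : ∀ f g x y, M₂ (f, x) (g, y) = if f = g then b₂ f (0, x) (0, y) else 0) :
    ∀ (f g : Fin Nf) (x y : α),
      (M₁ + M₂) (f, x) (g, y) = if f = g then (b₁ f + b₂ f) (0, x) (0, y) else 0 := by
  intro f g x y
  rw [Matrix.add_apply, h₁, h₂, Matrix.add_apply]
  by_cases hfg : f = g
  · rw [if_pos hfg, if_pos hfg, if_pos hfg]
  · rw [if_neg hfg, if_neg hfg, if_neg hfg, add_zero]

/-- Differences of flavour-block-diagonal matrices are flavour-block-diagonal, blockwise. -/
theorem sub_flavour {M₁ M₂ : Matrix (Fin Nf × α) (Fin Nf × α) ℂ}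
    {b₁ b₂ : Fin Nf → Matrix (Fin 1 × α) (Fin 1 × α) ℂ}
    (h₁ : ∀ f g x y, M₁ (f, x) (g, y) = if f = g then b₁ f (0, x) (0, y) else 0)
    (h₂ : ∀ f g x y, M₂ (f, x) (g, y) = if f = g then b₂ f (0, x) (0, y) else 0) :
    ∀ (f g : Fin Nf) (x y : α),
      (M₁ - M₂) (f, x) (g, y) = if f = g then (b₁ f - b₂ f) (0, x) (0, y) else 0 := by
  intro f g x y
  rw [Matrix.sub_apply, h₁, h₂, Matrix.sub_apply]
  by_cases hfg : f = g
  · rw [if_pos hfg, if_pos hfg, if_pos hfg]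
  · rw [if_neg hfg, if_neg hfg, if_neg hfg, sub_zero]

/-- Scalar multiples of a flavour-block-diagonal matrix are flavour-block-diagonal, blockwise. -/
theorem smul_flavour (c : ℂ) {M : Matrix (Fin Nf × α) (Fin Nf × α) ℂ}
    {b : Fin Nf → Matrix (Fin 1 × α) (Fin 1 × α) ℂ}
    (h : ∀ f g x y, M (f, x) (g, y) = if f = g then b f (0, x) (0, y) else 0) :
    ∀ (f g : Fin Nf) (x y : α),
      (c • M) (f, x) (g, y) = if f = g then (c • b f) (0, x) (0, y) else 0 := by
  intro f g x y
  rw [Matrix.smul_apply, h, Matrix.smul_apply, smul_eq_mul, smul_eq_mul, mul_ite, mul_zero]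

/-- Finite sums of flavour-block-diagonal matrices are flavour-block-diagonal, blockwise. -/
theorem sum_flavour {ι : Type*} (s : Finset ι)
    {M : ι → Matrix (Fin Nf × α) (Fin Nf × α) ℂ} {b : ι → Fin Nf → Matrix (Fin 1 × α) (Fin 1 × α) ℂ}
    (h : ∀ i f g x y, M i (f, x) (g, y) = if f = g then b i f (0, x) (0, y) else 0) :
    ∀ (f g : Fin Nf) (x y : α),
      (∑ i ∈ s, M i) (f, x) (g, y) = if f = g then (∑ i ∈ s, b i f) (0, x) (0, y) else 0 := by
  intro f g x y
  rw [Matrix.sum_apply, Matrix.sum_apply]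
  simp only [h]
  by_cases hfg : f = g
  · simp only [if_pos hfg]
  · simp only [if_neg hfg, Finset.sum_const_zero]

/-- The conjugate transpose of a flavour-block-diagonal matrix is flavour-block-diagonal, with the
conjugate-transposed blocks. -/
theorem conjTranspose_flavour {M : Matrix (Fin Nf × α) (Fin Nf × α) ℂ}
    {b : Fin Nf → Matrix (Fin 1 × α) (Fin 1 × α) ℂ}
    (h : ∀ f g x y, M (f, x) (g, y) = if f = g then b f (0, x) (0, y) else 0) :
    ∀ (f g : Fin Nf) (x y : α),
      Mᴴ (f, x) (g, y) = if f = g then (b f)ᴴ (0, x) (0, y) else 0 := by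
  intro f g x y
  rw [Matrix.conjTranspose_apply, h, Matrix.conjTranspose_apply]
  by_cases hfg : f = g
  · subst hfg
    rw [if_pos rfl, if_pos rfl]
  · rw [if_neg (Ne.symm hfg), if_neg hfg, star_zero]

/-- The identity matrix is flavour-block-diagonal with identity blocks. -/
theorem one_flavour [DecidableEq α] : ∀ (f g : Fin Nf) (x y : α),
    (1 : Matrix (Fin Nf × α) (Fin Nf × α) ℂ) (f, x) (g, y) =
      if f = g then (1 : Matrix (Fin 1 × α) (Fin 1 × α) ℂ) (0, x) (0, y) else 0 := by
  intro f g x y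
  simp only [Matrix.one_apply, Prod.mk.injEq, true_and, ite_and]

/-- Products of flavour-block-diagonal matrices are flavour-block-diagonal, blockwise. -/
theorem mul_flavour [Fintype α] {M₁ M₂ : Matrix (Fin Nf × α) (Fin Nf × α) ℂ}
    {b₁ b₂ : Fin Nf → Matrix (Fin 1 × α) (Fin 1 × α) ℂ}
    (h₁ : ∀ f g x y, M₁ (f, x) (g, y) = if f = g then b₁ f (0, x) (0, y) else 0)
    (h₂ : ∀ f g x y, M₂ (f, x) (g, y) = if f = g then b₂ f (0, x) (0, y) else 0) :
    ∀ (f g : Fin Nf) (x y : α),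
      (M₁ * M₂) (f, x) (g, y) = if f = g then (b₁ f * b₂ f) (0, x) (0, y) else 0 := by
  intro f g x y
  rw [Matrix.mul_apply, Fintype.sum_prod_type,
    Finset.sum_eq_single_of_mem f (Finset.mem_univ _) fun f' _ hf' => ?_]
  · simp only [h₁, h₂, if_true]
    by_cases hfg : f = g
    · subst hfg
      simp only [if_true, Matrix.mul_apply, Fintype.sum_prod_type, Finset.univ_unique,
        Fin.default_eq_zero, Finset.sum_singleton]
    · simp only [if_neg hfg, mul_zero, Finset.sum_const_zero]
  · simp only [h₁, if_neg (Ne.symm hf'), zero_mul, Finset.sum_const_zero]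

/-- Products over a list of flavour-block-diagonal matrices are flavour-block-diagonal, with the
blockwise list products. -/
theorem list_prod_flavour [Fintype α] [DecidableEq α] {ι : Type*}
    {M : ι → Matrix (Fin Nf × α) (Fin Nf × α) ℂ}
    {b : ι → Fin Nf → Matrix (Fin 1 × α) (Fin 1 × α) ℂ}
    (h : ∀ i f g x y, M i (f, x) (g, y) = if f = g then b i f (0, x) (0, y) else 0) :
    ∀ (l : List ι) (f g : Fin Nf) (x y : α),
      (l.map M).prod (f, x) (g, y) =
        if f = g then (l.map fun i => b i f).prod (0, x) (0, y) else 0 := by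
  intro l
  induction l with
  | nil =>
    intro f g x y
    rw [List.map_nil, List.map_nil, List.prod_nil, List.prod_nil]
    exact one_flavour f g x y
  | cons i l ih =>
    intro f g x y
    rw [List.map_cons, List.map_cons, List.prod_cons, List.prod_cons]
    exact mul_flavour (h i) ih f g x y

/-- The inverse of a flavour-block-diagonal matrix with invertible blocks is flavour-block-diagonal,
with the inverted blocks. -/
theorem inv_flavour [Fintype α] [DecidableEq α] {M : Matrix (Fin Nf × α) (Fin Nf × α) ℂ}
    {b : Fin Nf → Matrix (Fin 1 × α) (Fin 1 × α) ℂ}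
    (h : ∀ f g x y, M (f, x) (g, y) = if f = g then b f (0, x) (0, y) else 0)
    (hb : ∀ f, IsUnit (b f)) :
    ∀ (f g : Fin Nf) (x y : α),
      M⁻¹ (f, x) (g, y) = if f = g then (b f)⁻¹ (0, x) (0, y) else 0 := by
  have hB : ∀ (f g : Fin Nf) (x y : α),
      (Matrix.of fun p q : Fin Nf × α =>
          if p.1 = q.1 then (b p.1)⁻¹ (0, p.2) (0, q.2) else (0 : ℂ)) (f, x) (g, y) =
        if f = g then (b f)⁻¹ (0, x) (0, y) else 0 :=
    fun f g x y => rfl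
  have hBM : (Matrix.of fun p q : Fin Nf × α =>
      if p.1 = q.1 then (b p.1)⁻¹ (0, p.2) (0, q.2) else (0 : ℂ)) * M = 1 := by
    ext ⟨f, x⟩ ⟨g, y⟩
    rw [mul_flavour hB h, one_flavour]
    by_cases hfg : f = g
    · subst hfg
      rw [if_pos rfl, if_pos rfl,
        Matrix.nonsing_inv_mul _ ((Matrix.isUnit_iff_isUnit_det _).mp (hb f))]
    · rw [if_neg hfg, if_neg hfg]
  rw [Matrix.inv_eq_left_inv hBM]
  exact hB

/-- The determinant of a flavour-block-diagonal matrix is the product of the determinants of its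
blocks. -/
theorem det_flavour [Fintype α] [DecidableEq α] {M : Matrix (Fin Nf × α) (Fin Nf × α) ℂ}
    {b : Fin Nf → Matrix (Fin 1 × α) (Fin 1 × α) ℂ}
    (h : ∀ f g x y, M (f, x) (g, y) = if f = g then b f (0, x) (0, y) else 0) :
    M.det = ∏ f, (b f).det := by
  have hM : M = Matrix.reindex (Equiv.prodComm α (Fin Nf)) (Equiv.prodComm α (Fin Nf))
      (Matrix.blockDiagonal fun f =>
        (b f).submatrix (fun x => ((0 : Fin 1), x)) fun x => ((0 : Fin 1), x)) := by
    ext ⟨f, x⟩ ⟨g, y⟩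
    rw [h, Matrix.reindex_apply, Equiv.prodComm_symm, Matrix.submatrix_apply,
      Equiv.prodComm_apply, Equiv.prodComm_apply, Prod.swap_prod_mk, Prod.swap_prod_mk,
      Matrix.blockDiagonal_apply', Matrix.submatrix_apply]
  have hdet : ∀ f, ((b f).submatrix (fun x => ((0 : Fin 1), x)) fun x => ((0 : Fin 1), x)).det =
      (b f).det := fun f =>
    Matrix.det_submatrix_equiv_self
      (⟨fun x => (0, x), Prod.snd, fun _ => rfl,
          fun p => Prod.ext (Subsingleton.elim _ _) rfl⟩ : α ≃ Fin 1 × α) (b f)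
  rw [hM, Matrix.det_reindex_self, Matrix.det_blockDiagonal]
  exact Finset.prod_congr rfl fun f _ => hdet f

end Generic

/-! ### The slice matrices of the tree are flavour-block-diagonal -/

section Slice

variable {Nf S : ℕ} (V : GaugeConfig 3 S (Matrix.specialUnitaryGroup (Fin 3) ℂ))

/-- `sliceKron B Γ` of a flavour-block-diagonal spin-blind `B` is flavour-block-diagonal, with
blocks `sliceKron (b f) Γ`. -/
theorem sliceKron_flavour {B : Matrix (SliceColourVar Nf S) (SliceColourVar Nf S) ℂ}
    {b : Fin Nf → Matrix (SliceColourVar 1 S) (SliceColourVar 1 S) ℂ}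
    (h : ∀ f g x y, B (f, x) (g, y) = if f = g then b f (0, x) (0, y) else 0)
    (Γ : Matrix (Fin 4) (Fin 4) ℂ) :
    ∀ (f g : Fin Nf) (x y : TorusSite 3 S × Fin 3 × Fin 4),
      sliceKron B Γ (f, x) (g, y) = if f = g then sliceKron (b f) Γ (0, x) (0, y) else 0 := by
  intro f g x y
  simp only [sliceKron, Matrix.of_apply]
  rw [h, ite_mul, zero_mul]

/-- The forward colour hop `W_j` is flavour-block-diagonal with the one-flavour hop as block. -/
theorem colourHop_flavour (j : Fin 3) :
    ∀ (f g : Fin Nf) (x y : TorusSite 3 S × Fin 3),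
      colourHop V j (f, x) (g, y) = if f = g then colourHop (Nf := 1) V j (0, x) (0, y) else 0 := by
  intro f g x y
  simp only [colourHop, Matrix.of_apply, ite_and, if_true]

/-- `W_j + W_jᴴ` is flavour-block-diagonal with the one-flavour blocks. -/
theorem colourHop_add_conjTranspose_flavour :
    ∀ (j : Fin 3) (f g : Fin Nf) (x y : TorusSite 3 S × Fin 3),
      (colourHop (Nf := Nf) V j + (colourHop (Nf := Nf) V j)ᴴ) (f, x) (g, y) =
        if f = g then (colourHop (Nf := 1) V j + (colourHop (Nf := 1) V j)ᴴ) (0, x) (0, y)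
        else 0 :=
  fun j => add_flavour (colourHop_flavour V j) (conjTranspose_flavour (colourHop_flavour V j))

/-- `W_j − W_jᴴ` is flavour-block-diagonal with the one-flavour blocks. -/
theorem colourHop_sub_conjTranspose_flavour :
    ∀ (j : Fin 3) (f g : Fin Nf) (x y : TorusSite 3 S × Fin 3),
      (colourHop (Nf := Nf) V j - (colourHop (Nf := Nf) V j)ᴴ) (f, x) (g, y) =
        if f = g then (colourHop (Nf := 1) V j - (colourHop (Nf := 1) V j)ᴴ) (0, x) (0, y)
        else 0 :=
  fun j => sub_flavour (colourHop_flavour V j) (conjTranspose_flavour (colourHop_flavour V j))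

/-- The mass term `diag(m_f + 4)` is flavour-block-diagonal with blocks `diag(m_f + 4)`. -/
theorem massDiagonal_flavour (mq : Fin Nf → ℝ) :
    ∀ (f g : Fin Nf) (x y : TorusSite 3 S × Fin 3),
      Matrix.diagonal (fun p : SliceColourVar Nf S => ((mq p.1 + 4 : ℝ) : ℂ)) (f, x) (g, y) =
        if f = g then
          Matrix.diagonal
              (fun p : SliceColourVar 1 S => (((fun _ : Fin 1 => mq f) p.1 + 4 : ℝ) : ℂ))
            (0, x) (0, y)
        else 0 := by
  intro f g x y
  simp only [Matrix.diagonal_apply, Prod.mk.injEq, true_and, ite_and]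

/-- `1 ⊗ Γ` is flavour-block-diagonal with blocks `1 ⊗ Γ`. -/
theorem sliceKron_one_flavour (Γ : Matrix (Fin 4) (Fin 4) ℂ) :
    ∀ (f g : Fin Nf) (x y : TorusSite 3 S × Fin 3 × Fin 4),
      sliceKron (1 : Matrix (SliceColourVar Nf S) (SliceColourVar Nf S) ℂ) Γ (f, x) (g, y) =
        if f = g then
          sliceKron (1 : Matrix (SliceColourVar 1 S) (SliceColourVar 1 S) ℂ) Γ (0, x) (0, y)
        else 0 :=
  sliceKron_flavour one_flavour Γ

/-- The hop sum `½ Σ_j (W_j + W_jᴴ)` is flavour-block-diagonal with the one-flavour blocks. -/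
theorem hopSum_flavour :
    ∀ (f g : Fin Nf) (x y : TorusSite 3 S × Fin 3),
      ((1 / 2 : ℂ) • ∑ j : Fin 3, (colourHop (Nf := Nf) V j + (colourHop (Nf := Nf) V j)ᴴ))
          (f, x) (g, y) =
        if f = g then
          ((1 / 2 : ℂ) •
              ∑ j : Fin 3, (colourHop (Nf := 1) V j + (colourHop (Nf := 1) V j)ᴴ)) (0, x) (0, y)
        else 0 :=
  smul_flavour _ (sum_flavour _ (colourHop_add_conjTranspose_flavour V))

/-- The summands `(W_j − W_jᴴ) ⊗ γ₄γ_j` of the kinetic term are flavour-block-diagonal. -/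
theorem kineticTerm_flavour :
    ∀ (j : Fin 3) (f g : Fin Nf) (x y : TorusSite 3 S × Fin 3 × Fin 4),
      sliceKron (colourHop (Nf := Nf) V j - (colourHop (Nf := Nf) V j)ᴴ)
          (euclideanGamma 0 * euclideanGamma j.succ) (f, x) (g, y) =
        if f = g then
          sliceKron (colourHop (Nf := 1) V j - (colourHop (Nf := 1) V j)ᴴ)
            (euclideanGamma 0 * euclideanGamma j.succ) (0, x) (0, y)
        else 0 :=
  fun j => sliceKron_flavour (colourHop_sub_conjTranspose_flavour V j) _

/-- **The gauge rotation is flavour-block-diagonal** with the one-flavour `sliceGaugeRot` as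
blocks. -/
theorem sliceGaugeRot_flavour (g₀ : TorusSite 3 S → Matrix.specialUnitaryGroup (Fin 3) ℂ) :
    ∀ (f g : Fin Nf) (x y : TorusSite 3 S × Fin 3 × Fin 4),
      sliceGaugeRot (Nf := Nf) g₀ (f, x) (g, y) =
        if f = g then sliceGaugeRot (Nf := 1) g₀ (0, x) (0, y) else 0 := by
  have h : ∀ (f g : Fin Nf) (x y : TorusSite 3 S × Fin 3),
      (Matrix.of fun p q : SliceColourVar Nf S =>
          if p.1 = q.1 ∧ p.2.1 = q.2.1 then (g₀ p.2.1 : Matrix (Fin 3) (Fin 3) ℂ) p.2.2 q.2.2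
          else 0) (f, x) (g, y) =
        if f = g then
          (Matrix.of fun p q : SliceColourVar 1 S =>
              if p.1 = q.1 ∧ p.2.1 = q.2.1 then (g₀ p.2.1 : Matrix (Fin 3) (Fin 3) ℂ) p.2.2 q.2.2
              else 0) (0, x) (0, y)
        else 0 := by
    intro f g x y
    simp only [Matrix.of_apply, ite_and, if_true]
  unfold sliceGaugeRot
  exact sliceKron_flavour h 1

/-- **`A(U)` is flavour-block-diagonal**: the `f`-block of `sliceMassHop V mq` is the one-flavour
`sliceMassHop V (fun _ => mq f)`. -/
theorem sliceMassHop_flavour (mq : Fin Nf → ℝ) :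
    ∀ (f g : Fin Nf) (x y : TorusSite 3 S × Fin 3),
      sliceMassHop V mq (f, x) (g, y) =
        if f = g then sliceMassHop V (fun _ : Fin 1 => mq f) (0, x) (0, y) else 0 := by
  unfold sliceMassHop
  exact sub_flavour (massDiagonal_flavour mq) (hopSum_flavour V)

/-- **`D(U)` is flavour-block-diagonal** with the one-flavour `sliceDiracKinetic` as blocks. -/
theorem sliceDiracKinetic_flavour :
    ∀ (f g : Fin Nf) (x y : TorusSite 3 S × Fin 3 × Fin 4),
      sliceDiracKinetic (Nf := Nf) V (f, x) (g, y) =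
        if f = g then sliceDiracKinetic (Nf := 1) V (0, x) (0, y) else 0 := by
  unfold sliceDiracKinetic
  exact smul_flavour _ (sum_flavour _ (kineticTerm_flavour V))

variable [NeZero S]

/-- **`A(U)⁻¹` is flavour-block-diagonal** for `m_f > −1` (every one-flavour block is positive
definite, hence invertible): the `f`-block of `(sliceMassHop V mq)⁻¹` is
`(sliceMassHop V (fun _ => mq f))⁻¹`. -/
theorem sliceMassHop_inv_flavour (mq : Fin Nf → ℝ)
    (hm : ∀ f, -1 < mq f) :
    ∀ (f g : Fin Nf) (x y : TorusSite 3 S × Fin 3),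
      (sliceMassHop V mq)⁻¹ (f, x) (g, y) =
        if f = g then (sliceMassHop V (fun _ : Fin 1 => mq f))⁻¹ (0, x) (0, y) else 0 :=
  inv_flavour (sliceMassHop_flavour V mq) fun f =>
    (sliceMassHop_posDef 1 S V (fun _ : Fin 1 => mq f) fun _ => hm f).isUnit

/-- **`N = (1 ⊗ P⁻) D (1 ⊗ P⁺)` is flavour-block-diagonal** with the one-flavour `sliceNilp` as
blocks. -/
theorem sliceNilp_flavour :
    ∀ (f g : Fin Nf) (x y : TorusSite 3 S × Fin 3 × Fin 4),
      sliceNilp (Nf := Nf) V (f, x) (g, y) =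
        if f = g then sliceNilp (Nf := 1) V (0, x) (0, y) else 0 := by
  unfold sliceNilp
  exact mul_flavour (mul_flavour (sliceKron_one_flavour _) (sliceDiracKinetic_flavour V))
    (sliceKron_one_flavour _)

/-- **`M_F(U)` is flavour-block-diagonal** (for `m_f > −1`): the `f`-block of
`fermionSliceMatrix V mq` is the one-flavour `fermionSliceMatrix V (fun _ => mq f)`. -/
theorem fermionSliceMatrix_flavour (mq : Fin Nf → ℝ)
    (hm : ∀ f, -1 < mq f) :
    ∀ (f g : Fin Nf) (x y : TorusSite 3 S × Fin 3 × Fin 4),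
      fermionSliceMatrix V mq (f, x) (g, y) =
        if f = g then fermionSliceMatrix V (fun _ : Fin 1 => mq f) (0, x) (0, y) else 0 := by
  unfold fermionSliceMatrix
  exact mul_flavour
    (mul_flavour (sub_flavour one_flavour (sliceNilp_flavour V))
      (add_flavour (sliceKron_flavour (sliceMassHop_inv_flavour V mq hm) _)
        (sliceKron_flavour (sliceMassHop_flavour V mq) _)))
    (sub_flavour one_flavour (conjTranspose_flavour (sliceNilp_flavour V)))

end Slice

end FlavourBlocks

/-- **Stub `fermionSliceMatrix_flavour_apply` of line `Sketch`.**  For `m_f > −1` the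
one-particle fermionic transfer matrix `M_F(U) = (1 − N)(A⁻¹ ⊗ P⁺ + A ⊗ P⁻)(1 − N)ᴴ`
(Smit §6.5 (6.91)) is diagonal in flavour, its `f`-block being the one-flavour matrix of mass
`m_f`.
[cite: Smit2023, §6.5 (6.91)] -/
theorem fermionSliceMatrix_flavour_apply : ∀ (Nf S : ℕ) [NeZero S] (V : GaugeConfig 3 S (Matrix.specialUnitaryGroup (Fin 3) ℂ)) (mq : Fin Nf → ℝ), (∀ f, -1 < mq f) → ∀ (p q : SliceQuarkVar Nf S), fermionSliceMatrix V mq p q = if p.1 = q.1 then fermionSliceMatrix V (fun _ : Fin 1 => mq p.1) (0, p.2) (0, q.2) else 0 := by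
  intro Nf S _ V mq hm p q
  exact FlavourBlocks.fermionSliceMatrix_flavour V mq hm p.1 q.1 p.2 q.2

/-- **Stub `det_one_sub_transfer_prod_eq_prod_flavour` of line `Sketch`.**  For a four-torus gauge
field `U` and masses `m_f > −1`, the determinant of `1 − Π_i M_F(U_i) R(g_i)` (product over the
time slices `i < L` of the one-particle fermionic transfer matrix of the slice configuration `U_i`
times the gauge rotation by the temporal links `g_i`) factorises over flavours into the
one-flavour determinants. [cite: Smit2023, §6.5 (6.91)] -/
theorem det_one_sub_transfer_prod_eq_prod_flavour : ∀ (Nf L : ℕ) [NeZero L] (U : GaugeConfig 4 L (Matrix.specialUnitaryGroup (Fin 3) ℂ)) (mq : Fin Nf → ℝ), (∀ f, -1 < mq f) → (1 - ((List.range L).map fun i : ℕ => fermionSliceMatrix (fun e : Edge 3 L => U ((Fin.cons (i : ZMod L) e.1 : TorusSite 4 L), e.2.succ)) mq * sliceGaugeRot (Nf := Nf) (fun y : TorusSite 3 L => U ((Fin.cons (i : ZMod L) y : TorusSite 4 L), 0))).prod).det = ∏ f : Fin Nf, (1 - ((List.range L).map fun i : ℕ => fermionSliceMatrix (fun e : Edge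 3 L => U ((Fin.cons (i : ZMod L) e.1 : TorusSite 4 L), e.2.succ)) (fun _ : Fin 1 => mq f) * sliceGaugeRot (Nf := 1) (fun y : TorusSite 3 L => U ((Fin.cons (i : ZMod L) y : TorusSite 4 L), 0))).prod).det := by
  intro Nf L _ U mq hm
  exact FlavourBlocks.det_flavour
    (FlavourBlocks.sub_flavour FlavourBlocks.one_flavour
      (FlavourBlocks.list_prod_flavour
        (fun i : ℕ => FlavourBlocks.mul_flavour
          (FlavourBlocks.fermionSliceMatrix_flavour
            (fun e : Edge 3 L => U ((Fin.cons (i : ZMod L) e.1 : TorusSite 4 L), e.2.succ)) mq hm)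
          (FlavourBlocks.sliceGaugeRot_flavour
            (fun y : TorusSite 3 L => U ((Fin.cons (i : ZMod L) y : TorusSite 4 L), 0))))
        (List.range L)))

end Summit.QuantumFields.QCD.Cruxes.StableActionBridge.Sketch

end
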